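import Summits.Ventures.PercRepro.Night2FatZThreeB
import Summits.Ventures.PercRepro.Night2FatDegSingle

/-!
# night-2: the witnesses of the singly degenerate regime at small `N` — side points, free points, unloaded singletons — the cases P₂ = ∅ and P₂ = {c}, |P₃| = 1

**`exists_small_witnesses_deg`**: for every lossy basis pair of the singly degenerate regime there are sets `U` of side
points, `V` of free points and `E` of points on no non-class basis line (unloaded singletons) of `W ∖ {x}` in one of
four patterns: (α) the line of `M` is not a non-class basis line, `|U| = 2`, `|V| = 1`, `|E| ≥ 2`;
(β) `|U| = 1`, `|V| = 3`, `|E| ≥ 2`; (γ) `|U| = 2`, `|V| = 2`, `|E| ≥ 1`; (δ) `|U| = 1`, `|V| = 2`, `|E| ≥ 3`.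
Each pattern gives the fair share at `N = 6, 7, 8` (`Night2FatDegNumIccA/B`).  The case analysis follows
`exists_side_and_free_deg`: `|P₂| ∈ {0, 1, 2, 3}` basis points of `π₂` off the spine.
Paper `proofs/NIGHT-2-g35.md` §5.
-/

namespace PercRepro.Shadow

open PercRepro.ThmH PercRepro.PerFlat

variable {α : Type*} [DecidableEq α] {M : Matroid α} [M.Finite] {G : Finset α}

/-- The small witnesses when `P₂ = ∅`: three points of `π₂` off the spine, all free and on no basis line — pattern (β). -/
theorem deg_wit_case_p2_empty {w₀ x : α} {R₁ : Finset α} {c₂ c₃ : α} {B : Finset α} {z : α}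
    (hd : (gr M \ G).card = 2) (hk : kColoops M G = 1) (hfat : (fatClosures M 5 G 2).card ≤ 1) (hR₁2 : rkN M R₁ = 2)
    (hR₁3 : 3 ≤ R₁.card) (hcop : rkN M (insert w₀ (insert x R₁)) ≤ 3)
    (hnd₂ : 3 ≤ rkN M (((G \ coloops M G) \ {w₀, x}).filter (fun e => e ∈ clF M (insert c₂ R₁) ∧ e ∉ clF M R₁)))
    (hdeg₃ : rkN M (((G \ coloops M G) \ {w₀, x}).filter (fun e => e ∈ clF M (insert c₃ R₁) ∧ e ∉ clF M R₁)) ≤ 2)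
    {V P W Mset P₃ M' L₀ P₂ Aset Lset : Finset α} (hV : V = (G \ coloops M G) \ {w₀, x})
    (hP : P = (insert z B \ coloops M G).erase w₀) (hW : W = (G \ insert z B).erase x)
    (hMset : Mset = V.filter (fun e => e ∈ clF M (insert c₃ R₁) ∧ e ∉ clF M R₁))
    (hP₃ : P₃ = P.filter (fun e => e ∈ Mset)) (hM' : M' = W.filter (fun e => e ∈ Mset))
    (hL₀ : L₀ = P.filter (fun e => e ∈ clF M R₁))
    (hP₂ : P₂ = P.filter (fun e => e ∈ clF M (insert c₂ R₁) ∧ e ∉ clF M R₁))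
    (hAset : Aset = V.filter (fun e => e ∈ clF M (insert c₂ R₁) ∧ e ∉ clF M R₁))
    (hLset : Lset = V.filter (fun e => e ∈ clF M R₁)) {y₃ : α} (hP4 : P.card = 4) (hM3 : 3 ≤ Mset.card)
    (hM2 : 1 < Mset.card) (hP₃2 : P₃.card ≤ 2) (hMsplit : Mset.card = P₃.card + M'.card) (hM'1 : 1 ≤ M'.card)
    (hy₃ : y₃ ∈ W ∧ y₃ ∈ Mset) (hy₃side : y₃ ∈ clF M (insert c₃ R₁) ∧ y₃ ∉ clF M R₁) (hL₀2 : L₀.card ≤ 2)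
    (hπ₂3 : (P.filter (fun e => e ∈ clF M (insert c₂ R₁))).card ≤ 3) (hL₀P₂ : L₀.card + P₂.card ≤ 3)
    (hsplit : L₀.card + P₂.card + P₃.card = 4) (hAW : ∀ e ∈ Aset, e ∉ P₂ → e ∈ W) (hL3 : 3 ≤ Lset.card)
    (hfreeA : ∀ f ∈ Aset, f ∈ W → (∀ a ∈ L₀, ∀ c ∈ P₂, a ≠ c → f ∈ clF M {a, c} → rkN M (insert w₀ (insert x {a,
      c})) ≤ 3 → 4 ≤ rkN M ({a, c} ∪ Mset)) → (∀ c ∈ P₂, ∀ c' ∈ P₂, c ≠ c' → f ∈ clF M {c, c'} → rkN M (insert w₀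
      (insert x {c, c'})) ≤ 3 → 4 ≤ rkN M ({c, c'} ∪ Mset)) → f ∉ clF M Mset ∧ ∀ a ∈ P, ∀ b ∈ P, a ≠ b → f ∈ clF M
      {a, b} → rkN M (insert w₀ (insert x {a, b})) ≤ 3 → 4 ≤ rkN M ({a, b} ∪ Mset))
    (hA3 : 3 ≤ Aset.card)
    (hsingA : ∀ f ∈ Aset, f ∈ W → (∀ a ∈ L₀, ∀ c ∈ P₂, a ≠ c → f ∈ clF M {a, c} → rkN M (insert w₀ (insert x {a,
      c})) ≤ 3) → (∀ c ∈ P₂, ∀ c' ∈ P₂, c ≠ c' → f ∈ clF M {c, c'} → rkN M (insert w₀ (insert x {c, c'})) ≤ 3) → ∀ a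
      ∈ P, ∀ b ∈ P, a ≠ b → f ∈ clF M {a, b} → rkN M (insert w₀ (insert x {a, b})) ≤ 3)
    (hP₂0 : P₂.card < 1) :
    ∃ U V E : Finset α, U ⊆ (G \ insert z B).erase x ∧ (∀ y ∈ U, y ∈ clF M (insert c₃ R₁) ∧ y ∉ clF M R₁) ∧ V ⊆ (G
      \ insert z B).erase x ∧ (∀ f ∈ V, f ∉ clF M (((G \ coloops M G) \ {w₀, x}).filter (fun e => e ∈ clF M (insert
      c₃ R₁) ∧ e ∉ clF M R₁)) ∧ ∀ a ∈ (insert z B \ coloops M G).erase w₀, ∀ b ∈ (insert z B \ coloops M G).erase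
      w₀, a ≠ b → f ∈ clF M {a, b} → rkN M (insert w₀ (insert x {a, b})) ≤ 3 → 4 ≤ rkN M ({a, b} ∪ (((G \ coloops M
      G) \ {w₀, x}).filter (fun e => e ∈ clF M (insert c₃ R₁) ∧ e ∉ clF M R₁)))) ∧ E ⊆ (G \ insert z B).erase x ∧ (∀
      y ∈ E, ∀ a ∈ (insert z B \ coloops M G).erase w₀, ∀ b ∈ (insert z B \ coloops M G).erase w₀, a ≠ b → y ∈ clF M
      {a, b} → rkN M (insert w₀ (insert x {a, b})) ≤ 3) ∧ ((¬ (4 ≤ rkN M (insert w₀ (insert x (((G \ coloops M G) \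
      {w₀, x}).filter (fun e => e ∈ clF M (insert c₃ R₁) ∧ e ∉ clF M R₁)))) ∧ ∃ a ∈ (insert z B \ coloops M G).erase
      w₀, ∃ b ∈ (insert z B \ coloops M G).erase w₀, a ≠ b ∧ a ∈ clF M (((G \ coloops M G) \ {w₀, x}).filter (fun e
      => e ∈ clF M (insert c₃ R₁) ∧ e ∉ clF M R₁)) ∧ b ∈ clF M (((G \ coloops M G) \ {w₀, x}).filter (fun e => e ∈
      clF M (insert c₃ R₁) ∧ e ∉ clF M R₁))) ∧ U.card = 2 ∧ V.card = 1 ∧ 2 ≤ E.card) ∨ (U.card = 1 ∧ V.card = 3 ∧ 2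
      ≤ E.card) ∨ (U.card = 2 ∧ V.card = 2 ∧ 1 ≤ E.card) ∨ (U.card = 1 ∧ V.card = 2 ∧ 3 ≤ E.card)) := by
  subst hV hP hW hMset hP₃ hM' hL₀ hP₂ hAset hLset
  set V := (G \ coloops M G) \ {w₀, x} with hV
  set P := (insert z B \ coloops M G).erase w₀ with hP
  set W := (G \ insert z B).erase x with hW
  set Mset := V.filter (fun e => e ∈ clF M (insert c₃ R₁) ∧ e ∉ clF M R₁) with hMset
  set P₃ := P.filter (fun e => e ∈ Mset) with hP₃
  set M' := W.filter (fun e => e ∈ Mset) with hM'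
  set L₀ := P.filter (fun e => e ∈ clF M R₁) with hL₀
  set P₂ := P.filter (fun e => e ∈ clF M (insert c₂ R₁) ∧ e ∉ clF M R₁) with hP₂
  set Aset := V.filter (fun e => e ∈ clF M (insert c₂ R₁) ∧ e ∉ clF M R₁) with hAset
  set Lset := V.filter (fun e => e ∈ clF M R₁) with hLset
  have _u := hd
  have _u := hk
  have _u := hfat
  have _u := hR₁2
  have _u := hR₁3
  have _u := hcop
  have _u := hnd₂
  have _u := hdeg₃
  have _u := hP4
  have _u := hM3
  have _u := hM2
  have _u := hP₃2
  have _u := hMsplit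
  have _u := hM'1
  have _u := hL₀2
  have _u := hπ₂3
  have _u := hL₀P₂
  have _u := hsplit
  have _u := hL3
  have _u := hA3
  have _u := hP₂0
  have hP₂e : P₂ = ∅ := Finset.card_eq_zero.1 (by omega)
  have hnoP₂ : ∀ c, c ∉ P₂ := fun c hc => by rw [hP₂e] at hc; exact Finset.notMem_empty _ hc
  obtain ⟨f₁, hf₁, f₂, hf₂, f₃, hf₃, h12, h13, h23⟩ := Finset.two_lt_card.1 (by omega : 2 < Aset.card)
  have hfree : ∀ f ∈ Aset, f ∈ W ∧ (f ∉ clF M Mset ∧ ∀ a ∈ P, ∀ b ∈ P, a ≠ b → f ∈ clF M {a, b} →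
      rkN M (insert w₀ (insert x {a, b})) ≤ 3 → 4 ≤ rkN M ({a, b} ∪ Mset)) ∧
      ∀ a ∈ P, ∀ b ∈ P, a ≠ b → f ∈ clF M {a, b} → rkN M (insert w₀ (insert x {a, b})) ≤ 3 := by
    intro f hf
    have hfW : f ∈ W := hAW f hf (hnoP₂ f)
    exact ⟨hfW, hfreeA f hf hfW (fun a _ c hc => absurd hc (hnoP₂ c)) (fun c hc => absurd hc (hnoP₂ c)),
      hsingA f hf hfW (fun a _ c hc => absurd hc (hnoP₂ c)) (fun c hc => absurd hc (hnoP₂ c))⟩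
  refine ⟨{y₃}, {f₁, f₂, f₃}, {f₁, f₂, f₃}, Finset.singleton_subset_iff.2 hy₃.1, ?_, ?_, ?_, ?_, ?_,
    Or.inr (Or.inl ⟨Finset.card_singleton _, ?_, ?_⟩)⟩
  · intro y hy
    rw [Finset.mem_singleton] at hy
    subst hy
    exact hy₃side
  · intro f hf
    simp only [Finset.mem_insert, Finset.mem_singleton] at hf
    rcases hf with rfl | rfl | rfl
    · exact (hfree f hf₁).1
    · exact (hfree f hf₂).1
    · exact (hfree f hf₃).1
  · intro f hf
    simp only [Finset.mem_insert, Finset.mem_singleton] at hf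
    rcases hf with rfl | rfl | rfl
    · exact (hfree f hf₁).2.1
    · exact (hfree f hf₂).2.1
    · exact (hfree f hf₃).2.1
  · intro f hf
    simp only [Finset.mem_insert, Finset.mem_singleton] at hf
    rcases hf with rfl | rfl | rfl
    · exact (hfree f hf₁).1
    · exact (hfree f hf₂).1
    · exact (hfree f hf₃).1
  · intro f hf
    simp only [Finset.mem_insert, Finset.mem_singleton] at hf
    rcases hf with rfl | rfl | rfl
    · exact (hfree f hf₁).2.2
    · exact (hfree f hf₂).2.2
    · exact (hfree f hf₃).2.2
  · rw [Finset.card_insert_of_notMem, Finset.card_pair h23]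
    simp only [Finset.mem_insert, Finset.mem_singleton, not_or]
    exact ⟨h12, h13⟩
  · rw [Finset.card_insert_of_notMem, Finset.card_pair h23]
    · omega
    · simp only [Finset.mem_insert, Finset.mem_singleton, not_or]
      exact ⟨h12, h13⟩

/-- The small witnesses when `P₂ = {c}` and `|P₃| = 1` (`|L₀| = 2`): two side points — patterns (α) / (γ). -/
theorem deg_wit_case_p2_one_p3_one {w₀ x : α} {R₁ : Finset α} {c₂ c₃ : α} {B : Finset α} {z : α}
    (hd : (gr M \ G).card = 2) (hk : kColoops M G = 1) (hs : ∀ e ∈ gr M, ∀ f ∈ gr M, e ≠ f → rkN M {e, f} = 2)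
    (hfat : (fatClosures M 5 G 2).card ≤ 1) (hR₁2 : rkN M R₁ = 2) (hR₁3 : 3 ≤ R₁.card)
    (hcop : rkN M (insert w₀ (insert x R₁)) ≤ 3)
    (hcover : ∀ e ∈ (G \ coloops M G) \ {w₀, x}, e ∈ clF M (insert c₂ R₁) ∨ e ∈ clF M (insert c₃ R₁))
    (hnd₂ : 3 ≤ rkN M (((G \ coloops M G) \ {w₀, x}).filter (fun e => e ∈ clF M (insert c₂ R₁) ∧ e ∉ clF M R₁)))
    (hdeg₃ : rkN M (((G \ coloops M G) \ {w₀, x}).filter (fun e => e ∈ clF M (insert c₃ R₁) ∧ e ∉ clF M R₁)) ≤ 2)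
    {V P W Mset P₃ M' L₀ P₂ Aset Lset : Finset α} (hV : V = (G \ coloops M G) \ {w₀, x})
    (hP : P = (insert z B \ coloops M G).erase w₀) (hW : W = (G \ insert z B).erase x)
    (hMset : Mset = V.filter (fun e => e ∈ clF M (insert c₃ R₁) ∧ e ∉ clF M R₁))
    (hP₃ : P₃ = P.filter (fun e => e ∈ Mset)) (hM' : M' = W.filter (fun e => e ∈ Mset))
    (hL₀ : L₀ = P.filter (fun e => e ∈ clF M R₁))
    (hP₂ : P₂ = P.filter (fun e => e ∈ clF M (insert c₂ R₁) ∧ e ∉ clF M R₁))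
    (hAset : Aset = V.filter (fun e => e ∈ clF M (insert c₂ R₁) ∧ e ∉ clF M R₁))
    (hLset : Lset = V.filter (fun e => e ∈ clF M R₁)) {y₃ c : α} (hVg : V ⊆ gr M) (hPV : P ⊆ V)
    (hPW : ∀ e ∈ P, e ∉ W) (hP4 : P.card = 4) (hR₁g : R₁ ⊆ gr M) (hM3 : 3 ≤ Mset.card) (hM2 : 1 < Mset.card)
    (hMne : Mset.Nonempty) (hP₃2 : P₃.card ≤ 2) (hMsplit : Mset.card = P₃.card + M'.card) (hM'1 : 1 ≤ M'.card)
    (hy₃ : y₃ ∈ W ∧ y₃ ∈ Mset) (hy₃side : y₃ ∈ clF M (insert c₃ R₁) ∧ y₃ ∉ clF M R₁) (hL₀2 : L₀.card ≤ 2)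
    (hπ₂3 : (P.filter (fun e => e ∈ clF M (insert c₂ R₁))).card ≤ 3) (hL₀P₂ : L₀.card + P₂.card ≤ 3)
    (hsplit : L₀.card + P₂.card + P₃.card = 4) (hAW : ∀ e ∈ Aset, e ∉ P₂ → e ∈ W) (hL3 : 3 ≤ Lset.card)
    (hLM : ∀ s ∈ Lset, ∀ s' ∈ Lset, s ≠ s' → s ∈ clF M Mset → s' ∉ clF M Mset) (hAM : ∀ e ∈ Aset, e ∉ clF M Mset)
    (hspineM : ∀ a ∈ L₀, ∀ c ∈ P₂, rkN M ({a, c} ∪ Mset) ≤ 3 → a ∈ clF M Mset)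
    (htwo : P₃.card ≤ 1 → ∃ y₃' ∈ W, y₃' ≠ y₃ ∧ (y₃' ∈ clF M (insert c₃ R₁) ∧ y₃' ∉ clF M R₁))
    (hfreeA : ∀ f ∈ Aset, f ∈ W → (∀ a ∈ L₀, ∀ c ∈ P₂, a ≠ c → f ∈ clF M {a, c} → rkN M (insert w₀ (insert x {a,
      c})) ≤ 3 → 4 ≤ rkN M ({a, c} ∪ Mset)) → (∀ c ∈ P₂, ∀ c' ∈ P₂, c ≠ c' → f ∈ clF M {c, c'} → rkN M (insert w₀
      (insert x {c, c'})) ≤ 3 → 4 ≤ rkN M ({c, c'} ∪ Mset)) → f ∉ clF M Mset ∧ ∀ a ∈ P, ∀ b ∈ P, a ≠ b → f ∈ clF M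
      {a, b} → rkN M (insert w₀ (insert x {a, b})) ≤ 3 → 4 ≤ rkN M ({a, b} ∪ Mset))
    (hAoff : ∀ X : Finset α, rkN M X ≤ 2 → ∃ f ∈ Aset, f ∉ clF M X) (hA3 : 3 ≤ Aset.card)
    (hsingL : ∀ s ∈ W, s ∈ clF M R₁ → s ∉ clF M Mset → (∀ c ∈ P₂, ∀ c' ∈ P₂, c ≠ c' → s ∈ clF M {c, c'} → rkN M
      (insert w₀ (insert x {c, c'})) ≤ 3) → ∀ a ∈ P, ∀ b ∈ P, a ≠ b → s ∈ clF M {a, b} → rkN M (insert w₀ (insert x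
      {a, b})) ≤ 3)
    (hsingM : (¬ (4 ≤ rkN M (insert w₀ (insert x Mset)) ∧ ∃ a ∈ P, ∃ b ∈ P, a ≠ b ∧ a ∈ clF M Mset ∧ b ∈ clF M
      Mset)) → ∀ y ∈ W, (y ∈ clF M (insert c₃ R₁) ∧ y ∉ clF M R₁) → ∀ a ∈ P, ∀ b ∈ P, a ≠ b → y ∈ clF M {a, b} → rkN
      M (insert w₀ (insert x {a, b})) ≤ 3)
    (hnotcls : (4 ≤ rkN M (insert w₀ (insert x Mset))) → ∀ a ∈ L₀, a ∈ clF M Mset → ∀ c ∈ P₂, ¬ rkN M (insert w₀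
      (insert x {a, c})) ≤ 3)
    (hcmem : c ∈ P₂) (hcg : c ∈ gr M) (honly : ∀ c' ∈ P₂, c' = c)
    (hccvac : ∀ t : α, ∀ c' ∈ P₂, ∀ c'' ∈ P₂, c' ≠ c'' → t ∈ clF M {c', c''} → rkN M (insert w₀ (insert x {c',
      c''})) ≤ 3)
    (hccvac' : ∀ t : α, ∀ c' ∈ P₂, ∀ c'' ∈ P₂, c' ≠ c'' → t ∈ clF M {c', c''} → rkN M (insert w₀ (insert x {c',
      c''})) ≤ 3 → 4 ≤ rkN M ({c', c''} ∪ Mset))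
    (hA2 : 1 < (Aset.filter (fun e => e ∈ W)).card)
    (hLWcard : Lset.card ≤ (Lset.filter (fun e => e ∈ W)).card + L₀.card) (hP₂1 : 1 ≤ P₂.card) (hP₂1' : P₂.card < 2)
    (hP₃1 : P₃.card < 2) :
    ∃ U V E : Finset α, U ⊆ (G \ insert z B).erase x ∧ (∀ y ∈ U, y ∈ clF M (insert c₃ R₁) ∧ y ∉ clF M R₁) ∧ V ⊆ (G
      \ insert z B).erase x ∧ (∀ f ∈ V, f ∉ clF M (((G \ coloops M G) \ {w₀, x}).filter (fun e => e ∈ clF M (insert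
      c₃ R₁) ∧ e ∉ clF M R₁)) ∧ ∀ a ∈ (insert z B \ coloops M G).erase w₀, ∀ b ∈ (insert z B \ coloops M G).erase
      w₀, a ≠ b → f ∈ clF M {a, b} → rkN M (insert w₀ (insert x {a, b})) ≤ 3 → 4 ≤ rkN M ({a, b} ∪ (((G \ coloops M
      G) \ {w₀, x}).filter (fun e => e ∈ clF M (insert c₃ R₁) ∧ e ∉ clF M R₁)))) ∧ E ⊆ (G \ insert z B).erase x ∧ (∀
      y ∈ E, ∀ a ∈ (insert z B \ coloops M G).erase w₀, ∀ b ∈ (insert z B \ coloops M G).erase w₀, a ≠ b → y ∈ clF M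
      {a, b} → rkN M (insert w₀ (insert x {a, b})) ≤ 3) ∧ ((¬ (4 ≤ rkN M (insert w₀ (insert x (((G \ coloops M G) \
      {w₀, x}).filter (fun e => e ∈ clF M (insert c₃ R₁) ∧ e ∉ clF M R₁)))) ∧ ∃ a ∈ (insert z B \ coloops M G).erase
      w₀, ∃ b ∈ (insert z B \ coloops M G).erase w₀, a ≠ b ∧ a ∈ clF M (((G \ coloops M G) \ {w₀, x}).filter (fun e
      => e ∈ clF M (insert c₃ R₁) ∧ e ∉ clF M R₁)) ∧ b ∈ clF M (((G \ coloops M G) \ {w₀, x}).filter (fun e => e ∈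
      clF M (insert c₃ R₁) ∧ e ∉ clF M R₁))) ∧ U.card = 2 ∧ V.card = 1 ∧ 2 ≤ E.card) ∨ (U.card = 1 ∧ V.card = 3 ∧ 2
      ≤ E.card) ∨ (U.card = 2 ∧ V.card = 2 ∧ 1 ≤ E.card) ∨ (U.card = 1 ∧ V.card = 2 ∧ 3 ≤ E.card)) := by
  subst hV hP hW hMset hP₃ hM' hL₀ hP₂ hAset hLset
  set V := (G \ coloops M G) \ {w₀, x} with hV
  set P := (insert z B \ coloops M G).erase w₀ with hP
  set W := (G \ insert z B).erase x with hW
  set Mset := V.filter (fun e => e ∈ clF M (insert c₃ R₁) ∧ e ∉ clF M R₁) with hMset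
  set P₃ := P.filter (fun e => e ∈ Mset) with hP₃
  set M' := W.filter (fun e => e ∈ Mset) with hM'
  set L₀ := P.filter (fun e => e ∈ clF M R₁) with hL₀
  set P₂ := P.filter (fun e => e ∈ clF M (insert c₂ R₁) ∧ e ∉ clF M R₁) with hP₂
  set Aset := V.filter (fun e => e ∈ clF M (insert c₂ R₁) ∧ e ∉ clF M R₁) with hAset
  set Lset := V.filter (fun e => e ∈ clF M R₁) with hLset
  have _u := hd
  have _u := hk
  have _u := hfat
  have _u := hR₁2
  have _u := hR₁3
  have _u := hcop
  have _u := hnd₂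
  have _u := hdeg₃
  have _u := hP4
  have _u := hM3
  have _u := hM2
  have _u := hP₃2
  have _u := hMsplit
  have _u := hM'1
  have _u := hL₀2
  have _u := hπ₂3
  have _u := hL₀P₂
  have _u := hsplit
  have _u := hL3
  have _u := hA3
  have _u := hA2
  have _u := hLWcard
  have _u := hP₂1
  have _u := hP₂1'
  have _u := hP₃1
  obtain ⟨y₃', hy₃'W, hyy, hy₃'side⟩ := htwo (by omega)
  have hUc : ({y₃, y₃'} : Finset α).card = 2 := Finset.card_pair (Ne.symm hyy)
  have hUW : ({y₃, y₃'} : Finset α) ⊆ W :=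
    Finset.insert_subset hy₃.1 (Finset.singleton_subset_iff.2 hy₃'W)
  have hUside : ∀ y ∈ ({y₃, y₃'} : Finset α), y ∈ clF M (insert c₃ R₁) ∧ y ∉ clF M R₁ := by
    intro y hy
    rw [Finset.mem_insert, Finset.mem_singleton] at hy
    rcases hy with rfl | rfl
    · exact hy₃side
    · exact hy₃'side
  by_cases hNCL : ¬ (4 ≤ rkN M (insert w₀ (insert x Mset)) ∧
      ∃ a ∈ P, ∃ b ∈ P, a ≠ b ∧ a ∈ clF M Mset ∧ b ∈ clF M Mset)
  · -- pattern (α): a free point of `π₂` off the class line through the spine point of `clF M`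
    have hfreeA' : ∃ f ∈ Aset, f ∈ W ∧ (f ∉ clF M Mset ∧ ∀ a ∈ P, ∀ b ∈ P, a ≠ b → f ∈ clF M {a, b} →
        rkN M (insert w₀ (insert x {a, b})) ≤ 3 → 4 ≤ rkN M ({a, b} ∪ Mset)) := by
      by_cases hex : ∃ a₀ ∈ L₀, a₀ ∈ clF M Mset
      · obtain ⟨a₀, ha₀, ha₀M⟩ := hex
        have ha₀g : a₀ ∈ gr M := hVg (hPV (Finset.mem_filter.1 ha₀).1)
        have ha₀c : a₀ ≠ c := by
          rintro rfl
          exact (Finset.mem_filter.1 hcmem).2.2 (Finset.mem_filter.1 ha₀).2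
        obtain ⟨f, hf, hfoff⟩ := hAoff {a₀, c} (by rw [hs a₀ ha₀g c hcg ha₀c])
        have hfc : f ≠ c := by
          rintro rfl
          exact hfoff (subset_clF_of_subset_gr (Finset.insert_subset ha₀g (Finset.singleton_subset_iff.2 hcg))
            (Finset.mem_insert_of_mem (Finset.mem_singleton_self _)))
        have hfW : f ∈ W := hAW f hf (fun h => hfc (honly f h))
        refine ⟨f, hf, hfW, hfreeA f hf hfW ?_ (hccvac' f)⟩
        intro a ha c' hc' hac hfac hcls
        by_contra hcopl
        push Not at hcopl
        have hc'c : c' = c := honly c' hc'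
        subst hc'c
        have haM : a ∈ clF M Mset := hspineM a ha c' hcmem (by omega)
        have haa₀ : a = a₀ := by
          by_contra hne'
          exact hLM a (Finset.mem_filter.2 ⟨hPV (Finset.mem_filter.1 ha).1, (Finset.mem_filter.1 ha).2⟩)
            a₀ (Finset.mem_filter.2 ⟨hPV (Finset.mem_filter.1 ha₀).1, (Finset.mem_filter.1 ha₀).2⟩) hne' haM ha₀M
        subst haa₀
        exact hfoff hfac
      · push Not at hex
        obtain ⟨f, hf, hfoff⟩ := hAoff {c} (by
          have := rkN_le_card (M := M) ({c} : Finset α)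
          simp at this
          omega)
        have hfc : f ≠ c := by
          rintro rfl
          exact hfoff (subset_clF_of_subset_gr (Finset.singleton_subset_iff.2 hcg) (Finset.mem_singleton_self _))
        have hfW : f ∈ W := hAW f hf (fun h => hfc (honly f h))
        refine ⟨f, hf, hfW, hfreeA f hf hfW ?_ (hccvac' f)⟩
        intro a ha c' hc' hac hfac hcls
        by_contra hcopl
        push Not at hcopl
        have hc'c : c' = c := honly c' hc'
        subst hc'c
        exact hex a ha (hspineM a ha c' hcmem (by omega))
    obtain ⟨f, hf, hfW, hffree⟩ := hfreeA'
    refine ⟨{y₃, y₃'}, {f}, {y₃, y₃'}, hUW, hUside, Finset.singleton_subset_iff.2 hfW, ?_, hUW, ?_,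
      Or.inl ⟨hNCL, hUc, Finset.card_singleton _, by rw [hUc]⟩⟩
    · intro f' hf'
      rw [Finset.mem_singleton] at hf'
      subst hf'
      exact hffree
    · intro y hy
      exact hsingM hNCL y (hUW hy) (hUside y hy)
  · -- pattern (γ): the line of `M` is a non-class basis line through a spine basis point `a₀ ∈ clF M`; the
    -- spine–off lines `{a, c}` are then not class lines, so every point of `π₂` off the spine is free
    push Not at hNCL
    obtain ⟨hM4, a₀, ha₀P, b₀, hb₀P, hab₀, ha₀M, hb₀M⟩ := hNCL
    have hfreeall : ∀ f ∈ Aset, f ∈ W → (f ∉ clF M Mset ∧ ∀ a ∈ P, ∀ b ∈ P, a ≠ b → f ∈ clF M {a, b} →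
        rkN M (insert w₀ (insert x {a, b})) ≤ 3 → 4 ≤ rkN M ({a, b} ∪ Mset)) := by
      intro f hf hfW
      refine hfreeA f hf hfW ?_ (hccvac' f)
      intro a ha c' hc' hac hfac hcls
      have hc'c : c' = c := honly c' hc'
      subst hc'c
      by_contra hcopl
      push Not at hcopl
      have haM : a ∈ clF M Mset := hspineM a ha c' hcmem (by omega)
      exact hnotcls hM4 a ha haM c' hcmem hcls
    obtain ⟨f₁, hf₁, f₂, hf₂, hf₁₂⟩ := Finset.one_lt_card.1 hA2
    rw [Finset.mem_filter] at hf₁ hf₂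
    -- a spine point of `W`; it is off `clF M` since the spine point of `clF M` is a basis point
    have hLW1 : 0 < (Lset.filter (fun e => e ∈ W)).card := by omega
    obtain ⟨s, hsm⟩ := Finset.card_pos.1 hLW1
    rw [Finset.mem_filter] at hsm
    have hsM : s ∉ clF M Mset := by
      intro hsM
      have hside : ∀ t ∈ P, t ∈ clF M Mset → t ∉ Mset → t ∈ clF M R₁ := by
        intro t ht htM htS
        rcases spine_or_plane_or_side hcover (hPV ht) with h | ⟨h2, hL⟩ | h
        · exact h
        · exact absurd htM (hAM t (Finset.mem_filter.2 ⟨hPV ht, h2, hL⟩))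
        · exact absurd (Finset.mem_filter.2 ⟨hPV ht, h⟩) htS
      have hone : ∀ t ∈ P, t ∈ clF M Mset → t ∈ clF M R₁ → False := by
        intro t ht htM htL
        have hts : t = s := eq_of_mem_spine_of_mem_clF_side hs hVg hR₁g hR₁2 hdeg₃ hMne (hVg (hPV ht))
          (hVg (Finset.mem_filter.1 hsm.1).1) htL (Finset.mem_filter.1 hsm.1).2 htM hsM
        subst hts
        exact hPW t ht hsm.2
      by_cases ha₀S : a₀ ∈ Mset
      · by_cases hb₀S : b₀ ∈ Mset
        · have : ({a₀, b₀} : Finset α) ⊆ P₃ := by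
            intro t ht
            rw [Finset.mem_insert, Finset.mem_singleton] at ht
            rcases ht with rfl | rfl
            · exact Finset.mem_filter.2 ⟨ha₀P, ha₀S⟩
            · exact Finset.mem_filter.2 ⟨hb₀P, hb₀S⟩
          have := Finset.card_le_card this
          rw [Finset.card_pair hab₀] at this
          omega
        · exact hone b₀ hb₀P hb₀M (hside b₀ hb₀P hb₀M hb₀S)
      · exact hone a₀ ha₀P ha₀M (hside a₀ ha₀P ha₀M ha₀S)
    have hssing := hsingL s hsm.2 (Finset.mem_filter.1 hsm.1).2 hsM (hccvac s)
    refine ⟨{y₃, y₃'}, {f₁, f₂}, {s}, hUW, hUside, ?_, ?_, Finset.singleton_subset_iff.2 hsm.2, ?_,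
      Or.inr (Or.inr (Or.inl ⟨hUc, Finset.card_pair hf₁₂, by rw [Finset.card_singleton]⟩))⟩
    · intro f hf
      rw [Finset.mem_insert, Finset.mem_singleton] at hf
      rcases hf with rfl | rfl
      · exact hf₁.2
      · exact hf₂.2
    · intro f hf
      rw [Finset.mem_insert, Finset.mem_singleton] at hf
      rcases hf with rfl | rfl
      · exact hfreeall f hf₁.1 hf₁.2
      · exact hfreeall f hf₂.1 hf₂.2
    · intro y hy
      rw [Finset.mem_singleton] at hy
      subst hy
      exact hssing

end PercRepro.Shadow
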